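import Literature.Computability.Complexity.OrOfRestrictions
import HarnessLib

/-!
# The code of the OR of restrictions (specification of the preprocessing machine)

Literature / circuit complexity. In the proof of Williams' Theorem 4.1 (R. Williams,
*Nonuniform ACC circuit lower bounds*, J. ACM 61 (2014), Thm. 4.1) the given circuit `C` on `n`
inputs is first replaced by `C' =` the OR of the `2^ℓ` copies of `C` with the first `ℓ` inputs
fixed (`Circuit.orRestrictions`, file `OrOfRestrictions.lean`). The assembled algorithm
(`Williams2014AccSatAssembly.lean`, hypothesis `hP`) needs a MACHINE printing the string code
`encodeAccCircuit m C'` from `encodeAccCircuit m C`. This file is the list-level specification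
of that machine: an explicit description `orCodeList m C ℓ` of `circuitCodeList m C'` as a
function of the header (`n`, output wire, size) and the gate codes of `C` — every copy `a < 2^ℓ`
is the block `[∨₀, ∧₀]` (codes `[2,0]`, `[1,0]`) followed by the gates of `C` with their wires
re-addressed (`copyWire`: an input `i < ℓ` becomes the constant gate `a(s+2) + bitᵢ(a)`, an
input `i ≥ ℓ` the input `i - ℓ`, a gate `j` the gate `a(s+2) + j + 2`), then one `∨` gate of
fan-in `2^ℓ` reading the re-addressed output wires — and the theorem
`circuitCodeList_orRestrictions : circuitCodeList m (C.orRestrictions ℓ) = orCodeList m C ℓ`.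
Auxiliary: the juxtaposition `GateList.parBlocks` of equally long blocks in closed form
(`parBlocks_fst_ofFn`, `parBlocks_snd_ofFn`), and the symbolic codes of the constant gates and
of `∨ₖ` (`accCode_const_false = 2`, `accCode_const_true = 1`, `accCode_or : 1 if k = 1 else 2`
— `∨₁ = ∧₁` extensionally and `∧` is tested first).

## References

* R. Williams, *Nonuniform ACC circuit lower bounds*, J. ACM 61(1) (2014) 2:1–2:32, proof of
  Thm. 4.1 [Williams2014].
* H. Vollmer, *Introduction to Circuit Complexity*, Springer 1999, §1.2 (composition of
  circuits) [Vollmer1999].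
-/

namespace Literature.Computability.Complexity

open GateList MetaComplexity

variable {ι : Type*} {n : ℕ}

/-! ### Iterated relocation -/

namespace GateList

/-- Two shifts along `Sum.inl` compose additively. [folklore] -/
theorem shiftWire_inl_shiftWire_inl (L₁ L₂ : ℕ) (w : ι ⊕ ℕ) :
    shiftWire Sum.inl L₁ (shiftWire (Sum.inl : ι → ι ⊕ ℕ) L₂ w) = shiftWire Sum.inl (L₂ + L₁) w := by
  cases w <;> simp [shiftWire, Nat.add_assoc]

/-- The shift by `0` is the identity. [folklore] -/
theorem shiftWire_inl_zero (w : ι ⊕ ℕ) : shiftWire (Sum.inl : ι → ι ⊕ ℕ) 0 w = w := by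
  cases w <;> rfl

/-- `par` shifts compose additively. [folklore] -/
theorem par_par (L₁ L₂ : ℕ) (g : Gate ι) : par L₁ (par L₂ g) = par (L₂ + L₁) g := by
  obtain ⟨k, op, args⟩ := g
  simp only [par, reloc, shiftWire_inl_shiftWire_inl]

/-- `par 0` is the identity. [folklore] -/
theorem par_zero (g : Gate ι) : par 0 g = g := by
  obtain ⟨k, op, args⟩ := g
  simp only [par, reloc, shiftWire_inl_zero]

/-- **Juxtaposition of equally long blocks, gates**: block `a` is relocated by `a · w`.
[cite: Vollmer1999, §1.2] -/
theorem parBlocks_fst_ofFn {L w : ℕ} (f : Fin L → List (Gate ι) × (ι ⊕ ℕ))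
    (hw : ∀ a, (f a).1.length = w) :
    (parBlocks (List.ofFn f)).1 = (List.finRange L).flatMap fun a : Fin L => (f a).1.map (par ((a : ℕ) * w)) := by
  induction L with
  | zero => simp [parBlocks]
  | succ L ih =>
    rw [List.ofFn_succ, List.finRange_succ, List.flatMap_cons, Fin.val_zero, zero_mul]
    rcases hf : f 0 with ⟨gs, o⟩
    have hgs : gs.length = w := by simpa [hf] using hw 0
    simp only [parBlocks, ih (fun i => f i.succ) (fun a => hw _), List.map_flatMap, List.map_map,
      List.flatMap_map, hgs]
    congr 1
    · conv_lhs => rw [← List.map_id gs]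
      exact List.map_congr_left fun g _ => (par_zero g).symm
    · refine List.flatMap_congr fun a _ => List.map_congr_left fun g _ => ?_
      simp only [Function.comp_apply, par_par, Fin.val_succ, Nat.succ_mul]

/-- **Juxtaposition of equally long blocks, output wires**: the output wire of block `a` is
shifted by `a · w`. [cite: Vollmer1999, §1.2] -/
theorem parBlocks_snd_ofFn {L w : ℕ} (f : Fin L → List (Gate ι) × (ι ⊕ ℕ))
    (hw : ∀ a, (f a).1.length = w) :
    (parBlocks (List.ofFn f)).2 = (List.finRange L).map fun a : Fin L => shiftWire Sum.inl ((a : ℕ) * w) (f a).2 := by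
  induction L with
  | zero => simp [parBlocks]
  | succ L ih =>
    rw [List.ofFn_succ, List.finRange_succ, List.map_cons, Fin.val_zero, zero_mul,
      shiftWire_inl_zero]
    rcases hf : f 0 with ⟨gs, o⟩
    have hgs : gs.length = w := by simpa [hf] using hw 0
    simp only [parBlocks, ih (fun i => f i.succ) (fun a => hw _), List.map_map, hgs]
    congr 1
    refine List.map_congr_left fun a _ => ?_
    simp only [Function.comp_apply, shiftWire_inl_shiftWire_inl, Fin.val_succ, Nat.succ_mul]

end GateList

/-! ### Symbolic codes of the constants and of `∨ₖ` -/

/-- The constant `0 = ∨₀` has code `2`. [folklore] -/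
theorem accCode_const_false (m : ℕ) : accCode m (GateFn.const false) = 2 := by
  unfold accCode
  have h0 : GateFn.const false ≠ GateFn.not := fun h => by
    have := congrArg Sigma.fst h; simp [GateFn.const, GateFn.not] at this
  have h1 : GateFn.const false ≠ GateFn.and (GateFn.const false).1 := fun h => by
    simp only [GateFn.const, GateFn.and, Sigma.mk.injEq, heq_eq_eq, true_and] at h
    have := congrFun h Fin.elim0
    simp at this
  have h2 : GateFn.const false = GateFn.or (GateFn.const false).1 := by
    simp only [GateFn.const, GateFn.or, Sigma.mk.injEq, heq_eq_eq, true_and]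
    funext v; simp
  rw [if_neg h0, if_neg h1, if_pos h2]

/-- The constant `1 = ∧₀` has code `1`. [folklore] -/
theorem accCode_const_true (m : ℕ) : accCode m (GateFn.const true) = 1 := by
  unfold accCode
  have h0 : GateFn.const true ≠ GateFn.not := fun h => by
    have := congrArg Sigma.fst h; simp [GateFn.const, GateFn.not] at this
  have h1 : GateFn.const true = GateFn.and (GateFn.const true).1 := by
    simp only [GateFn.const, GateFn.and, Sigma.mk.injEq, heq_eq_eq, true_and]
    funext v; simp
  rw [if_neg h0, if_pos h1]

/-- The code of `∨ₖ` is `2`, except `∨₁`, which coincides with `∧₁` (the identity) and is coded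
`1` (conjunctions are tested first). [folklore] -/
theorem accCode_or (m k : ℕ) : accCode m (GateFn.or k) = if k = 1 then 1 else 2 := by
  unfold accCode
  have h0 : GateFn.or k ≠ GateFn.not := fun h => by
    by_cases hk : k = 1
    · subst hk
      simp only [GateFn.or, GateFn.not, Sigma.mk.injEq, heq_eq_eq, true_and] at h
      have := congrFun h fun _ => true
      simp at this
    · have := congrArg Sigma.fst h
      exact hk (by simpa [GateFn.or, GateFn.not] using this)
  rw [if_neg h0]
  by_cases hk : k = 1
  · subst hk
    have h1 : GateFn.or 1 = GateFn.and (GateFn.or 1).1 := by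
      simp only [GateFn.or, GateFn.and, Sigma.mk.injEq, heq_eq_eq, true_and]
      funext v
      simp [Fin.exists_fin_one, Fin.forall_fin_one]
    rw [if_pos h1, if_pos rfl]
  · have h1 : GateFn.or k ≠ GateFn.and (GateFn.or k).1 := fun h => by
      simp only [GateFn.or, GateFn.and, Sigma.mk.injEq, heq_eq_eq, true_and] at h
      rcases Nat.lt_or_gt_of_ne hk with hk0 | hk2
      · have hk0 : k = 0 := by omega
        subst hk0
        have := congrFun h Fin.elim0
        simp at this
      · have := congrFun h fun i => decide (i = ⟨0, by omega⟩)
        have h' : ∀ i : Fin k, i = ⟨0, by omega⟩ := by simpa using this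
        exact absurd (congrArg Fin.val (h' ⟨1, hk2⟩)) (by simp)
    have h2 : GateFn.or k = GateFn.or (GateFn.or k).1 := rfl
    rw [if_neg h1, if_pos h2, if_neg hk]

/-! ### Codes of the re-addressed wires and gates -/

/-- The tree's enumeration of the cube reads off binary digits. [folklore] -/
theorem boolFunEquivFin_symm_eq_testBit (ℓ : ℕ) (a : Fin (2 ^ ℓ)) (i : Fin ℓ) :
    (boolFunEquivFin ℓ).symm a i = (a : ℕ).testBit i := by
  have h : ((finFunctionFinEquiv.symm a i : Fin 2) : ℕ) = a / 2 ^ (i : ℕ) % 2 :=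
    finFunctionFinEquiv_symm_apply_val a i
  change (finFunctionFinEquiv.symm a i == 1) = _
  rw [Nat.testBit_eq_decide_div_mod_eq, ← h]
  generalize finFunctionFinEquiv.symm a i = x
  revert x
  decide

/-- **The code of a wire of copy `a` placed at offset `A`**: an input `i < ℓ` becomes the
constant gate `A + bitᵢ(a)` (`∨₀` at `A`, `∧₀` at `A + 1`), an input `i ≥ ℓ` the new input
`i - ℓ`, the gate `j` the gate `A + j + 2`. [cite: Williams2014, Thm. 4.1] -/
def copyWire (ℓ A a : ℕ) : Fin n ⊕ ℕ → List ℕ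
  | Sum.inl i => if (i : ℕ) < ℓ then [1, A + (a.testBit i).toNat] else [0, i - ℓ]
  | Sum.inr j => [1, A + (j + 2)]

/-- Every re-addressed wire code has two entries. [folklore] -/
@[simp] theorem length_copyWire (ℓ A a : ℕ) (w : Fin n ⊕ ℕ) : (copyWire ℓ A a w).length = 2 := by
  rcases w with i | j
  · simp only [copyWire]; split_ifs <;> rfl
  · rfl

/-- The wire `w` of `C`, hard-wired along the assignment number `a` and placed at offset `A`,
has code `copyWire ℓ A a w`. [cite: Williams2014, Thm. 4.1] -/
theorem wireCode_shift_hwWire (ℓ A : ℕ) (a : Fin (2 ^ ℓ)) (w : Fin n ⊕ ℕ) :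
    wireCode (shiftWire Sum.inl A
      (shiftWire (hwWire (plugWire n ℓ ((boolFunEquivFin ℓ).symm a)) : Fin n → Fin (n - ℓ) ⊕ ℕ) 2 w)) =
      copyWire ℓ A a w := by
  rcases w with i | j
  · simp only [shiftWire, hwWire, plugWire, copyWire]
    by_cases hi : (i : ℕ) < ℓ
    · rw [dif_pos hi, if_pos hi, Sum.elim_inr, boolFunEquivFin_symm_eq_testBit]
      cases (a : ℕ).testBit i <;> simp [wireCode, Nat.add_comm]
    · rw [dif_neg hi, if_neg hi, Sum.elim_inl]
      rfl
  · simp only [shiftWire, wireCode, copyWire, Nat.add_comm]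

/-- **The code of a gate of copy `a` at offset `A`**: its own symbolic code and arity, then its
re-addressed wires. [cite: Williams2014, Thm. 4.1] -/
def copyGate (m ℓ A a : ℕ) (g : Gate (Fin n)) : List ℕ :=
  accCode m g.fn :: g.arity :: (List.ofFn g.args).flatMap (copyWire ℓ A a)

/-- The relocated gate has code `copyGate`. [cite: Williams2014, Thm. 4.1] -/
theorem gateCodeList_par_reloc (m ℓ A : ℕ) (a : Fin (2 ^ ℓ)) (g : Gate (Fin n)) :
    gateCodeList m (par A (reloc (hwWire (plugWire n ℓ ((boolFunEquivFin ℓ).symm a)) :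
      Fin n → Fin (n - ℓ) ⊕ ℕ) 2 g)) = copyGate m ℓ A a g := by
  obtain ⟨k, op, args⟩ := g
  simp only [gateCodeList, par, reloc, Gate.fn, copyGate]
  refine congrArg _ (congrArg _ ?_)
  rw [show (fun i => shiftWire Sum.inl A (shiftWire (hwWire (plugWire n ℓ ((boolFunEquivFin ℓ).symm a)) :
      Fin n → Fin (n - ℓ) ⊕ ℕ) 2 (args i))) = (fun w => shiftWire Sum.inl A
      (shiftWire (hwWire (plugWire n ℓ ((boolFunEquivFin ℓ).symm a)) : Fin n → Fin (n - ℓ) ⊕ ℕ) 2 w)) ∘ args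
      from rfl, ← List.map_ofFn, List.flatMap_map]
  exact List.flatMap_congr fun w _ => wireCode_shift_hwWire ℓ A a w

/-- **The code of copy `a`** (at offset `a (s + 2)`): the constants `∨₀`, `∧₀`, then the gates
of `C` re-addressed. [cite: Williams2014, Thm. 4.1] -/
def copyBlock (m : ℕ) (C : Circuit (Fin n)) (ℓ a : ℕ) : List ℕ :=
  2 :: 0 :: 1 :: 0 :: C.gates.flatMap (copyGate m ℓ (a * (C.size + 2)) a)

/-- The gate list of copy `a` has code `copyBlock`. [cite: Williams2014, Thm. 4.1] -/
theorem flatMap_gateCodeList_orCopy (m : ℕ) (C : Circuit (Fin n)) (ℓ : ℕ) (a : Fin (2 ^ ℓ)) :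
    ((C.orCopy ℓ a).1.map (par ((a : ℕ) * (C.size + 2)))).flatMap (gateCodeList m) =
      copyBlock m C ℓ a := by
  have e0 : gateCodeList m (par ((a : ℕ) * (C.size + 2)) (GateList.constGate (Fin (n - ℓ)) false)) = [2, 0] := by
    have : (par ((a : ℕ) * (C.size + 2)) (GateList.constGate (Fin (n - ℓ)) false)).fn = GateFn.const false := rfl
    rw [gateCodeList, this, accCode_const_false]
    rfl
  have e1 : gateCodeList m (par ((a : ℕ) * (C.size + 2)) (GateList.constGate (Fin (n - ℓ)) true)) = [1, 0] := by
    have : (par ((a : ℕ) * (C.size + 2)) (GateList.constGate (Fin (n - ℓ)) true)).fn = GateFn.const true := rfl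
    rw [gateCodeList, this, accCode_const_true]
    rfl
  have hlen : (hwPre : List (Gate (Fin (n - ℓ)))).length = 2 := rfl
  simp only [Circuit.orCopy, hwGates, hlen, List.map_append, List.flatMap_append, List.map_map,
    List.flatMap_map, Function.comp_apply]
  rw [show (hwPre : List (Gate (Fin (n - ℓ)))) = [GateList.constGate _ false, GateList.constGate _ true]
    from rfl]
  simp only [List.flatMap_cons, List.flatMap_nil, List.append_nil, e0, e1,
    copyBlock, List.cons_append, List.nil_append, List.cons.injEq, true_and]
  exact List.flatMap_congr fun g _ => gateCodeList_par_reloc m ℓ _ a g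

/-- **The code of the OR of the `2^ℓ` restrictions** as a function of the code of `C`: header
`[n - ℓ, 1, G, G + 1]` (`G = 2^ℓ (s + 2)` gates before the final `∨`, which is the output), the
`2^ℓ` copies, the final gate `∨` of fan-in `2^ℓ` reading the re-addressed output wires.
[cite: Williams2014, Thm. 4.1] -/
def orCodeList (m : ℕ) (C : Circuit (Fin n)) (ℓ : ℕ) : List ℕ :=
  (n - ℓ) :: 1 :: (2 ^ ℓ * (C.size + 2)) :: (2 ^ ℓ * (C.size + 2) + 1) ::
    ((List.range (2 ^ ℓ)).flatMap (copyBlock m C ℓ) ++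
      (accCode m (GateFn.or (2 ^ ℓ)) :: 2 ^ ℓ ::
        (List.range (2 ^ ℓ)).flatMap fun a => copyWire ℓ (a * (C.size + 2)) a C.output))

/-- The body of the OR of restrictions has `2^ℓ (s + 2)` gates. [folklore] -/
theorem length_orBody_fst (C : Circuit (Fin n)) (ℓ : ℕ) :
    (C.orBody ℓ).1.length = 2 ^ ℓ * (C.size + 2) := by
  rw [Circuit.orBody, length_parBlocks_fst, Circuit.orBlocks, List.map_ofFn]
  have : (fun b : List (Gate (Fin (n - ℓ))) × (Fin (n - ℓ) ⊕ ℕ) => b.1.length) ∘ C.orCopy ℓ =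
      fun _ => C.size + 2 := by
    funext a; simp [Circuit.orCopy, Circuit.size, Nat.add_comm]
  rw [this, List.ofFn_const, List.sum_replicate, smul_eq_mul]

/-- **Specification of the preprocessing machine**: the code of `C.orRestrictions ℓ` is
`orCodeList m C ℓ`. [cite: Williams2014, Thm. 4.1] -/
theorem circuitCodeList_orRestrictions (m : ℕ) (C : Circuit (Fin n)) (ℓ : ℕ) :
    circuitCodeList m (C.orRestrictions ℓ) = orCodeList m C ℓ := by
  have hG := length_orBody_fst C ℓ
  have hsize : (C.orRestrictions ℓ).size = 2 ^ ℓ * (C.size + 2) + 1 := by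
    simp [Circuit.orRestrictions, toCircuit, Circuit.size, Circuit.orGates, hG]
  have hgates : (C.orRestrictions ℓ).gates = (C.orBody ℓ).1 ++ [bigGate false (2 ^ ℓ) (C.orArgs ℓ)] := rfl
  have hout : (C.orRestrictions ℓ).output = Sum.inr (C.orBody ℓ).1.length := rfl
  have hw : ∀ a : Fin (2 ^ ℓ), (C.orCopy ℓ a).1.length = C.size + 2 := fun a => by
    simp [Circuit.orCopy, Circuit.size, Nat.add_comm]
  -- the copies
  have hbody : (C.orBody ℓ).1.flatMap (gateCodeList m) = (List.range (2 ^ ℓ)).flatMap (copyBlock m C ℓ) := by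
    rw [Circuit.orBody, Circuit.orBlocks, parBlocks_fst_ofFn _ hw, List.flatMap_assoc,
      ← List.map_coe_finRange_eq_range, List.flatMap_map]
    exact List.flatMap_congr fun a _ => flatMap_gateCodeList_orCopy m C ℓ a
  -- the final gate
  have hfin : gateCodeList m (bigGate false (2 ^ ℓ) (C.orArgs ℓ)) = accCode m (GateFn.or (2 ^ ℓ)) ::
      2 ^ ℓ :: (List.range (2 ^ ℓ)).flatMap fun a => copyWire ℓ (a * (C.size + 2)) a C.output := by
    have hargs : List.ofFn (C.orArgs ℓ) = (C.orBody ℓ).2 := by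
      apply List.ext_getElem
      · rw [List.length_ofFn, Circuit.length_orBody_snd]
      · intro i h1 h2
        rw [List.getElem_ofFn]
        rfl
    have hfn : (bigGate false (2 ^ ℓ) (C.orArgs ℓ) : Gate (Fin (n - ℓ))).fn = GateFn.or (2 ^ ℓ) := rfl
    show accCode m (bigGate false (2 ^ ℓ) (C.orArgs ℓ) : Gate (Fin (n - ℓ))).fn :: 2 ^ ℓ ::
      (List.ofFn (C.orArgs ℓ)).flatMap wireCode = _
    rw [hfn, hargs, Circuit.orBody, Circuit.orBlocks, parBlocks_snd_ofFn _ hw, ← List.map_coe_finRange_eq_range,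
      List.flatMap_map, List.flatMap_map]
    refine congrArg _ (congrArg _ (List.flatMap_congr fun a _ => ?_))
    exact wireCode_shift_hwWire ℓ _ a C.output
  rw [circuitCodeList, hout, hsize, hgates, List.flatMap_append, hbody, List.flatMap_cons,
    List.flatMap_nil, List.append_nil, hfin, hG, orCodeList]
  rfl

end Literature.Computability.Complexity
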